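import Summits.CriticalPhenomena.PercolationContinuityZ3.Theorems.PercAnnulusCrossingIICRecurrent
import HarnessLib

/-!
# Kesten's IIC is recurrent FROM EVERY VERTEX: no unit flow of finite energy from any site of the cluster of the root (lane RSW3, p1 gen 27)

builds on p205010 (kernel theorem, internal audit signed; external expert review pending) — NOT used in this file (every `d ≥ 1`, `p > 0` with
`θ(p) = 0`, every IIC probability measure).

RSW3 lane (LANE 3 `prim-rsw3`), seat `prim-rsw3-p1` (gen 27).  Helper file (`--supports stmt-CriticalPhenomena-4575`); no definitions,
no sorries.  Memo `run/shared/lean/prim/rsw3/P1-QM.md` §40.6.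

`…IICRecurrent` proved: `ν`-a.s. the root admits no finite-energy unit flow to infinity (infinitely many cut-edges + Nash-Williams).
Recurrence is a property of the GRAPH `C(0)`, not of the root: a cut-edge `e` of the root lying off a fixed open path `0 ↝ y` leaves `y` in
the same finite piece, so every `y ∈ C(0)` also has infinitely many single-edge cutsets, and Nash-Williams from the source `y` applies.

* `inv_card_le_sum_sq_src_zd`, `nashWilliams_src_zd` — Nash-Williams in flow form from an arbitrary source `v` (`…IICRecurrent` had `v = 0`);
* `exists_box_forall_not_mem_reachable_sdiff` — an open path `0 ↝ y` lies in some `Λ(m₀).sym2`; closing an edge off `Λ(m₀).sym2` keeps `0 ↔ y`;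
* **`iicMeasure_ae_forall_mem_infinite_cutEdges`** — `ν`-a.s. EVERY `y ∈ C(0)` has infinitely many edges `e` with `|C_{ω∖{e}}(y)| < ∞`;
* **`iicMeasure_ae_forall_mem_not_exists_finiteEnergyFlow`** — **`ν`-a.s., for every `y ∈ C(0)`, there is no antisymmetric `f` on the open
  edges, divergence-free off `y`, with unit out-flow at `y` and `Σ f² < ∞`: the incipient infinite cluster is a RECURRENT GRAPH**.
References: R. Lyons, Y. Peres (2016) (2.14), Thm. 2.11, Exercise 2.1 (recurrence does not depend on the starting vertex); H. Kesten, AIHP 22 (1986).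
-/

noncomputable section

namespace Summit.CriticalPhenomena.PercolationContinuityZ3.Theorems.Crossing

open MeasureTheory Filter Topology Literature.Probability.Percolation Literature.Probability.LatticeModels
open Literature.Probability.Percolation.DCT16
open scoped Literature.Probability.Percolation ENNReal

variable {d : ℕ}

/-! ## §1 Nash-Williams from an arbitrary source -/

/-- **Flux through one cutset from the source `v`** (`ℤ^d`): as `…IICRecurrent.inv_card_le_sum_sq_zd` with the root `0` replaced by `v`.
[cite: LyonsPeres2016, (2.14)] -/
theorem inv_card_le_sum_sq_src_zd {ω : BondConfig (Site d)} {v : Site d} {cut : Finset (Sym2 (Site d))}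
    (hfin : (openCluster (ω \ ↑cut) v).Finite) {f : Site d → Site d → ℝ}
    (hanti : ∀ x y, f x y = -f y x) (hsupp : ∀ x y, f x y ≠ 0 → (zdGraph d).Adj x y ∧ s(x, y) ∈ ω)
    (hdiv : ∀ x, x ≠ v → ∑ y ∈ (zdGraph d).neighborFinset x, f x y = 0)
    (hsrc : ∑ y ∈ (zdGraph d).neighborFinset v, f v y = 1) :
    ((cut.card : ℝ))⁻¹ ≤ ∑ q ∈ (hfin.toFinset.biUnion fun x => (((zdGraph d).neighborFinset x).filter
        (fun y => y ∉ hfin.toFinset ∧ s(x, y) ∈ cut)).image (fun y => (x, y))), f q.1 q.2 ^ 2 := by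
  classical
  set A : Finset (Site d) := hfin.toFinset with hA
  have hA0 : v ∈ A := by rw [hA, Set.Finite.mem_toFinset]; exact mem_openCluster_self _ _
  have hmemA : ∀ {x y : Site d}, x ∈ A → s(x, y) ∈ ω → s(x, y) ∉ cut → x ≠ y → y ∈ A := by
    intro x y hx hω hc hne
    rw [hA, Set.Finite.mem_toFinset] at hx ⊢
    exact SimpleGraph.Reachable.trans hx (SimpleGraph.Adj.reachable ((openGraph_adj _ x y).2 ⟨⟨hω, hc⟩, hne⟩))
  set B : Finset (Site d × Site d) := A.biUnion fun x => (((zdGraph d).neighborFinset x).filter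
      (fun y => y ∉ A ∧ s(x, y) ∈ cut)).image (fun y => (x, y)) with hB
  have hmemB : ∀ q : Site d × Site d, q ∈ B ↔ q.1 ∈ A ∧ (zdGraph d).Adj q.1 q.2 ∧ q.2 ∉ A ∧ s(q.1, q.2) ∈ cut := by
    rintro ⟨x, y⟩
    simp only [hB, Finset.mem_biUnion, Finset.mem_image, Finset.mem_filter, SimpleGraph.mem_neighborFinset, Prod.mk.injEq]
    constructor
    · rintro ⟨x', hx', y', ⟨hadj, hy', hc⟩, rfl, rfl⟩; exact ⟨hx', hadj, hy', hc⟩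
    · rintro ⟨hx, hadj, hy, hc⟩; exact ⟨x, hx, y, ⟨hadj, hy, hc⟩, rfl, rfl⟩
  have hflux : ∑ x ∈ A, ∑ y ∈ (zdGraph d).neighborFinset x, f x y = 1 := by
    rw [← Finset.add_sum_erase A _ hA0, hsrc, Finset.sum_eq_zero fun x hx => hdiv x (Finset.ne_of_mem_erase hx), add_zero]
  have hsplit : ∀ x ∈ A, ∑ y ∈ (zdGraph d).neighborFinset x, f x y =
      ∑ y ∈ ((zdGraph d).neighborFinset x).filter (fun y => y ∈ A), f x y +
        ∑ y ∈ ((zdGraph d).neighborFinset x).filter (fun y => y ∉ A), f x y := fun x _ =>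
    (Finset.sum_filter_add_sum_filter_not _ _ _).symm
  have hext : ∀ x ∈ A, ∑ y ∈ ((zdGraph d).neighborFinset x).filter (fun y => y ∉ A), f x y =
      ∑ y ∈ ((zdGraph d).neighborFinset x).filter (fun y => y ∉ A ∧ s(x, y) ∈ cut), f x y := by
    intro x hx
    symm
    refine Finset.sum_subset (fun y hy => ?_) (fun y hy hy' => ?_)
    · rw [Finset.mem_filter] at hy ⊢; exact ⟨hy.1, hy.2.1⟩
    · rw [Finset.mem_filter] at hy hy'
      by_contra hne
      have h := hsupp x y hne
      have hyc : s(x, y) ∈ cut := by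
        by_contra hc
        exact hy.2 (hmemA hx h.2 hc h.1.ne)
      exact hy' ⟨hy.1, hy.2, hyc⟩
  have hone : ∑ q ∈ B, f q.1 q.2 = 1 := by
    have h1 : ∑ q ∈ B, f q.1 q.2 = ∑ x ∈ A, ∑ y ∈ ((zdGraph d).neighborFinset x).filter (fun y => y ∉ A ∧ s(x, y) ∈ cut), f x y := by
      rw [hB, Finset.sum_biUnion]
      · refine Finset.sum_congr rfl fun x _ => ?_
        rw [Finset.sum_image fun y _ y' _ h => (Prod.mk.injEq _ _ _ _ ▸ h).2]
      · intro x _ x' _ hxx'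
        simp only [Function.onFun]
        rw [Finset.disjoint_left]
        intro q hq hq'
        rw [Finset.mem_image] at hq hq'
        obtain ⟨y, -, rfl⟩ := hq
        obtain ⟨y', -, h⟩ := hq'
        exact hxx' ((Prod.mk.injEq _ _ _ _ ▸ h).1.symm)
    rw [h1]
    have h2 := sum_filter_adj_eq_zero_zd A f hanti
    rw [← hflux, Finset.sum_congr rfl hsplit, Finset.sum_add_distrib, h2, zero_add]
    exact (Finset.sum_congr rfl hext).symm
  have hcardB : B.card ≤ cut.card := by
    refine Finset.card_le_card_of_injOn (fun q => s(q.1, q.2)) (fun q hq => ((hmemB q).1 (Finset.mem_coe.1 hq)).2.2.2) ?_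
    rintro ⟨x, y⟩ hq ⟨x', y'⟩ hq' h
    have h1 := (hmemB _).1 (Finset.mem_coe.1 hq)
    have h2 := (hmemB _).1 (Finset.mem_coe.1 hq')
    rcases Sym2.eq_iff.1 h with ⟨rfl, rfl⟩ | ⟨rfl, rfl⟩
    · rfl
    · exact absurd h2.1 h1.2.2.1
  have hcs := Finset.sum_mul_sq_le_sq_mul_sq B (fun q => f q.1 q.2) (fun _ => (1 : ℝ))
  simp only [mul_one, one_pow, Finset.sum_const, nsmul_eq_mul, mul_one] at hcs
  rw [hone, one_pow] at hcs
  have hBpos : 0 < (B.card : ℝ) := by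
    rcases Nat.eq_zero_or_pos B.card with h | h
    · rw [h] at hcs; simp at hcs; linarith
    · exact_mod_cast h
  have hS : ((B.card : ℝ))⁻¹ ≤ ∑ q ∈ B, f q.1 q.2 ^ 2 := by
    rw [inv_le_iff_one_le_mul₀ hBpos]
    linarith
  refine le_trans ?_ hS
  exact inv_anti₀ hBpos (by exact_mod_cast hcardB)

/-- **NASH-WILLIAMS IN FLOW FORM FROM THE SOURCE `v`** (`ℤ^d`): pairwise disjoint finite edge sets `cut_k`, each leaving `v` in a finite piece,
bound the energy of every unit flow from `v` on the open edges: `Σ_{k<n} |cut_k|⁻¹ ≤ Σ f²`. [cite: LyonsPeres2016, (2.14)] -/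
theorem nashWilliams_src_zd {ω : BondConfig (Site d)} {v : Site d} (cut : ℕ → Finset (Sym2 (Site d)))
    (hfin : ∀ k, (openCluster (ω \ ↑(cut k)) v).Finite) (hdisj : Pairwise fun i j => Disjoint (cut i) (cut j))
    {f : Site d → Site d → ℝ} (hanti : ∀ x y, f x y = -f y x) (hsupp : ∀ x y, f x y ≠ 0 → (zdGraph d).Adj x y ∧ s(x, y) ∈ ω)
    (hdiv : ∀ x, x ≠ v → ∑ y ∈ (zdGraph d).neighborFinset x, f x y = 0) (hsrc : ∑ y ∈ (zdGraph d).neighborFinset v, f v y = 1)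
    (hsum : Summable (fun q : Site d × Site d => f q.1 q.2 ^ 2)) (n : ℕ) :
    ∑ k ∈ Finset.range n, ((cut k).card : ℝ)⁻¹ ≤ ∑' q : Site d × Site d, f q.1 q.2 ^ 2 := by
  classical
  set B : ℕ → Finset (Site d × Site d) := fun k => (hfin k).toFinset.biUnion fun x => (((zdGraph d).neighborFinset x).filter
      (fun y => y ∉ (hfin k).toFinset ∧ s(x, y) ∈ cut k)).image (fun y => (x, y)) with hB
  have hmemB : ∀ k q, q ∈ B k → s(q.1, q.2) ∈ cut k := by
    intro k q hq
    simp only [hB, Finset.mem_biUnion, Finset.mem_image, Finset.mem_filter] at hq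
    obtain ⟨x, -, y, ⟨-, -, hc⟩, rfl⟩ := hq
    exact hc
  have hk : ∀ k, ((cut k).card : ℝ)⁻¹ ≤ ∑ q ∈ B k, f q.1 q.2 ^ 2 := fun k =>
    inv_card_le_sum_sq_src_zd (hfin k) hanti hsupp hdiv hsrc
  have hdisjB : ∀ k ∈ Finset.range n, ∀ j ∈ Finset.range n, k ≠ j → Disjoint (B k) (B j) := by
    intro k _ j _ hkj
    rw [Finset.disjoint_left]
    intro q hq hq'
    exact Finset.disjoint_left.1 (hdisj hkj) (hmemB k q hq) (hmemB j q hq')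
  calc ∑ k ∈ Finset.range n, ((cut k).card : ℝ)⁻¹ ≤ ∑ k ∈ Finset.range n, ∑ q ∈ B k, f q.1 q.2 ^ 2 :=
        Finset.sum_le_sum fun k _ => hk k
    _ = ∑ q ∈ (Finset.range n).biUnion B, f q.1 q.2 ^ 2 := (Finset.sum_biUnion hdisjB).symm
    _ ≤ ∑' q : Site d × Site d, f q.1 q.2 ^ 2 := hsum.sum_le_tsum _ fun q _ => sq_nonneg _

/-! ## §2 Every vertex of the cluster has infinitely many single-edge cutsets -/

/-- **An open path `x ↝ y` lies inside some `Λ(m₀).sym2`**: then for every `e` off `Λ(m₀).sym2`, `y` stays in the cluster of `x` in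
`ω ∖ {e}`. [folklore] -/
theorem exists_box_forall_not_mem_reachable_sdiff {ω : BondConfig (Site d)} {x y : Site d} (h : (openGraph ω).Reachable x y) :
    ∃ m₀ : ℕ, ∀ e : Sym2 (Site d), e ∉ (↑((box d m₀).sym2) : Set (Sym2 (Site d))) → (openGraph (ω \ {e})).Reachable x y := by
  classical
  obtain ⟨p⟩ := h
  obtain ⟨m₀, hm₀⟩ := exists_subset_box p.support.toFinset
  refine ⟨m₀, fun e he => ?_⟩
  have hedges : ∀ e' ∈ p.edges, e' ∈ (openGraph (ω \ {e})).edgeSet := by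
    intro e' he'
    induction e' using Sym2.ind with
    | h u v =>
      have hadj : (openGraph ω).Adj u v := p.adj_of_mem_edges he'
      have h1 := (openGraph_adj ω u v).1 hadj
      refine (SimpleGraph.mem_edgeSet _).2 ((openGraph_adj _ u v).2 ⟨⟨h1.1, fun h' => he ?_⟩, h1.2⟩)
      rw [Set.mem_singleton_iff] at h'
      rw [← h', Finset.coe_sym2, Set.mk_mem_sym2_iff]
      exact ⟨Finset.mem_coe.2 (hm₀ (List.mem_toFinset.2 (p.fst_mem_support_of_mem_edges he'))),
        Finset.mem_coe.2 (hm₀ (List.mem_toFinset.2 (p.snd_mem_support_of_mem_edges he')))⟩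
  exact ⟨p.transfer _ hedges⟩

/-- **EVERY VERTEX OF THE IIC'S CLUSTER HAS INFINITELY MANY SINGLE-EDGE CUTSETS, almost surely** (`θ(p) = 0`, `0 < p`, `d ≥ 1`; every IIC
probability measure): `ν`-a.s., for every `y ∈ C(0)` the set of OPEN edges `e` with `|C_{ω∖{e}}(y)| < ∞` is infinite (the root's cut-edges
beyond a box containing a path `0 ↝ y`, `…IICRecurrent.iicMeasure_ae_forall_exists_cutEdge`). [cite: Kesten1986, Thm. (14)] -/
theorem iicMeasure_ae_forall_mem_infinite_cutEdges (hd : 1 ≤ d) (p : unitInterval) (hp : 0 < (p : ℝ)) (hθ : theta (zdGraph d) 0 p = 0)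
    {ν : Measure (BondConfig (Site d))} [IsProbabilityMeasure ν]
    (hν : ∀ (F : Finset (Sym2 (Site d))) (E : Set (BondConfig (Site d))), MeasurableSet E → DeterminedBy E ↑F →
      Tendsto (fun n : ℕ => (bondPercolation (zdGraph d) p).real (E ∩ siteToBoundary d n) / oneArmProb d p n)
        atTop (𝓝 (ν.real E))) :
    ∀ᵐ ω ∂ν, ∀ y ∈ openCluster ω (0 : Site d),
      {e : Sym2 (Site d) | e ∈ ω ∧ ω \ {e} ∉ percolatesAt y}.Infinite := by
  classical
  filter_upwards [iicMeasure_ae_forall_exists_cutEdge hd p hp hθ hν] with ω hcut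
  intro y hy hfin
  obtain ⟨m₀, hm₀⟩ := exists_box_forall_not_mem_reachable_sdiff (show (openGraph ω).Reachable 0 y from hy)
  -- a finite set of pairs lies inside some `Λ(M).sym2`
  have hbox : ∀ e : Sym2 (Site d), ∃ r : ℕ, e ∈ (↑((box d r).sym2) : Set (Sym2 (Site d))) := by
    intro e
    induction e using Sym2.ind with
    | h u v =>
      obtain ⟨r, hr⟩ := exists_subset_box ({u, v} : Finset (Site d))
      refine ⟨r, ?_⟩
      rw [Finset.coe_sym2, Set.mk_mem_sym2_iff]
      exact ⟨Finset.mem_coe.2 (hr (by simp)), Finset.mem_coe.2 (hr (by simp))⟩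
  choose r hr using hbox
  set M : ℕ := max m₀ (hfin.toFinset.sup r) with hM
  obtain ⟨e, heM, heω, hecut⟩ := hcut M
  -- `e` is off `Λ(m₀).sym2`, so `y` stays with `0`, whose piece is finite
  have hem₀ : e ∉ (↑((box d m₀).sym2) : Set (Sym2 (Site d))) := fun h =>
    heM (Finset.coe_subset.2 (Finset.sym2_mono (box_mono d (le_max_left _ _))) h)
  have hy' : (openGraph (ω \ {e})).Reachable 0 y := hm₀ e hem₀
  have hcuty : ω \ {e} ∉ percolatesAt y := by
    intro hpy
    refine hecut ?_
    have heq : openCluster (ω \ {e}) (0 : Site d) = openCluster (ω \ {e}) y := by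
      ext z
      exact ⟨fun hz => SimpleGraph.Reachable.trans hy'.symm hz, fun hz => SimpleGraph.Reachable.trans hy' hz⟩
    show (openCluster (ω \ {e}) (0 : Site d)).Infinite
    rw [heq]; exact hpy
  have heS : e ∈ hfin.toFinset := by rw [Set.Finite.mem_toFinset]; exact ⟨heω, hcuty⟩
  have hrM : r e ≤ M := (Finset.le_sup (f := r) heS).trans (le_max_right _ _)
  exact heM (Finset.coe_subset.2 (Finset.sym2_mono (box_mono d hrM)) (hr e))

/-- **KESTEN'S IIC IS A RECURRENT GRAPH** (`θ(p) = 0`, `0 < p`, `d ≥ 1`; every probability measure with Kesten's IIC limit property): `ν`-a.s.,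
for EVERY site `y` of the cluster of the root there is NO antisymmetric `f` on the open edges, divergence-free off `y`, with unit out-flow
at `y` and finite energy — simple random walk on the incipient infinite cluster is recurrent from every starting point (T. Lyons' criterion;
Nash-Williams from the source `y`). [cite: LyonsPeres2016, (2.14) and Thm. 2.11] [cite: Kesten1986, Thm. (14)] -/
theorem iicMeasure_ae_forall_mem_not_exists_finiteEnergyFlow (hd : 1 ≤ d) (p : unitInterval) (hp : 0 < (p : ℝ))
    (hθ : theta (zdGraph d) 0 p = 0) {ν : Measure (BondConfig (Site d))} [IsProbabilityMeasure ν]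
    (hν : ∀ (F : Finset (Sym2 (Site d))) (E : Set (BondConfig (Site d))), MeasurableSet E → DeterminedBy E ↑F →
      Tendsto (fun n : ℕ => (bondPercolation (zdGraph d) p).real (E ∩ siteToBoundary d n) / oneArmProb d p n)
        atTop (𝓝 (ν.real E))) :
    ∀ᵐ ω ∂ν, ∀ y ∈ openCluster ω (0 : Site d), ¬ ∃ f : Site d → Site d → ℝ, (∀ x z, f x z = -f z x) ∧
      (∀ x z, f x z ≠ 0 → (zdGraph d).Adj x z ∧ s(x, z) ∈ ω) ∧
      (∀ x, x ≠ y → ∑ z ∈ (zdGraph d).neighborFinset x, f x z = 0) ∧ ∑ z ∈ (zdGraph d).neighborFinset y, f y z = 1 ∧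
      Summable (fun q : Site d × Site d => f q.1 q.2 ^ 2) := by
  classical
  filter_upwards [iicMeasure_ae_forall_mem_infinite_cutEdges hd p hp hθ hν] with ω hinf
  rintro y hy ⟨f, hanti, hsupp, hdiv, hsrc, hsum⟩
  set S : Set (Sym2 (Site d)) := {e : Sym2 (Site d) | e ∈ ω ∧ ω \ {e} ∉ percolatesAt y} with hS
  have hSinf : S.Infinite := hinf y hy
  set emb : ℕ ↪ S := hSinf.natEmbedding S with hemb
  set cut : ℕ → Finset (Sym2 (Site d)) := fun k => {((emb k : S) : Sym2 (Site d))} with hcut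
  have hfin : ∀ k, (openCluster (ω \ ↑(cut k)) y).Finite := by
    intro k
    have h := (emb k).2
    simp only [hS, Set.mem_setOf_eq, percolatesAt] at h
    rw [hcut, Finset.coe_singleton]
    exact Set.not_infinite.1 h.2
  have hdisj : Pairwise fun i j => Disjoint (cut i) (cut j) := by
    intro i j hij
    rw [hcut, Finset.disjoint_singleton]
    exact fun h => hij (emb.injective (Subtype.ext h))
  have hNW := nashWilliams_src_zd cut hfin hdisj hanti hsupp hdiv hsrc hsum
  obtain ⟨n, hn⟩ := exists_nat_gt (∑' q : Site d × Site d, f q.1 q.2 ^ 2)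
  have h := hNW n
  simp only [hcut, Finset.card_singleton, Nat.cast_one, inv_one, Finset.sum_const, Finset.card_range, nsmul_eq_mul, mul_one] at h
  linarith

end Summit.CriticalPhenomena.PercolationContinuityZ3.Theorems.Crossing

end
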